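import Mathlib.Analysis.SpecificLimits.Normed
import HarnessLib

/-!
# Corner window (abstract form) — stub `stub_cornerWindow` of line `rectangle-windows`
(crux EdgeOfPositivity, stmt-CriticalPhenomena-11344)

Pure real analysis over abstract sequences `ℕ → ℝ`.  `T` is a nonnegative sequence that is
supermultiplicative through one extra step, `x · T p · T q ≤ T (p + q + 1)`, and supercritical,
`θ := x · T p₀ > 1` for some `p₀`.  By induction on `k`, `θ ^ (k+1) ≤ x · T (p₀ + k (p₀ + 1))`
(geometric growth along an arithmetic progression of spans).  The two "diagonal" sequences
satisfy `K · T (ℓ - 1) ≤ Dᵢ ℓ` (`K > 0`), so along `ℓ_k = p₀ + k (p₀ + 1) + 1` the product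
`D₁ ℓ_k · D₂ ℓ_k ≥ (K / x)² · θ ^ (2 (k + 1))` grows exponentially in `k`, while the "round trip"
sequence obeys `0 ≤ R ℓ ≤ C (ℓ + 1)`, so `R ℓ_k ² ≤ C² (p₀ + 2)² (k + 1)²` grows only
quadratically; exponential beats quadratic (`tendsto_pow_const_div_const_pow_of_one_lt`), whence
`R ℓ ² < D₁ ℓ · D₂ ℓ` at some span `ℓ ≥ 1`.  Sources: folklore real analysis.
-/

noncomputable section

open Filter Topology

namespace Summit.CriticalPhenomena.SAWScalingLimit.Theorems.EdgeOfPositivity.RectangleWindows.CornerWindow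

/-- Geometric growth along an arithmetic progression of spans from one-step
supermultiplicativity: if `x · T p · T q ≤ T (p + q + 1)` for all `p, q` and `0 < x`,
`0 ≤ x · T p₀`, then `(x · T p₀) ^ (k + 1) ≤ x · T (p₀ + k (p₀ + 1))` for every `k`. [folklore] -/
theorem pow_succ_le_through {x : ℝ} {T : ℕ → ℝ} (hx : 0 < x)
    (hmul : ∀ p q : ℕ, x * T p * T q ≤ T (p + q + 1)) (p₀ : ℕ) (hθ : 0 ≤ x * T p₀) :
    ∀ k : ℕ, (x * T p₀) ^ (k + 1) ≤ x * T (p₀ + k * (p₀ + 1)) := by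
  intro k
  induction k with
  | zero => simp
  | succ k ih =>
    have h := hmul (p₀ + k * (p₀ + 1)) p₀
    have hidx : p₀ + k * (p₀ + 1) + p₀ + 1 = p₀ + (k + 1) * (p₀ + 1) := by ring
    rw [hidx] at h
    calc (x * T p₀) ^ (k + 1 + 1) = (x * T p₀) ^ (k + 1) * (x * T p₀) := pow_succ _ _
      _ ≤ x * T (p₀ + k * (p₀ + 1)) * (x * T p₀) := mul_le_mul_of_nonneg_right ih hθ
      _ = x * (x * T (p₀ + k * (p₀ + 1)) * T p₀) := by ring
      _ ≤ x * T (p₀ + (k + 1) * (p₀ + 1)) := mul_le_mul_of_nonneg_left h hx.le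

/-- Exponential beats quadratic: for `0 < B` and `1 < r` there is `k` with
`A (k + 1)² < B · r ^ (k + 1)`. [folklore] -/
theorem exists_sq_lt_pow {A B r : ℝ} (hB : 0 < B) (hr : 1 < r) :
    ∃ k : ℕ, A * ((k : ℝ) + 1) ^ 2 < B * r ^ (k + 1) := by
  have h1 : Tendsto (fun n : ℕ => A * ((n : ℝ) ^ 2 / r ^ n)) atTop (𝓝 (A * 0)) :=
    (tendsto_pow_const_div_const_pow_of_one_lt 2 hr).const_mul A
  rw [mul_zero] at h1
  obtain ⟨n, hn1, hn⟩ := ((eventually_ge_atTop 1).and (h1.eventually_lt_const hB)).exists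
  have hrn : 0 < r ^ n := pow_pos (zero_lt_one.trans hr) n
  rw [← mul_div_assoc, div_lt_iff₀ hrn] at hn
  obtain ⟨k, rfl⟩ := Nat.exists_eq_add_of_le' hn1
  refine ⟨k, ?_⟩
  push_cast at hn
  exact hn

/-- **Corner window, abstract form** (pure real analysis; no walks).  `T` is the through
function of the supercritical width (`x·T(p)·T(q) ≤ T(p+q+1)`, `x·T(p) ≤ T(p+1)`, `T ≥ 0`, some
`x·T(p₀) > 1`), `D₁, D₂` the two diagonal corner functions (`K·T(ℓ-1) ≤ Dᵢ(ℓ)`, `K > 0`), `R` the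
round-trip function (`0 ≤ R(ℓ) ≤ C(ℓ+1)`).  Then `x·T(p₀ + k(p₀+1)) ≥ θ^{k+1}` with
`θ = x·T(p₀) > 1` (induction on `k` by supermultiplicativity), so along `ℓ_k = p₀ + k(p₀+1) + 1`
the crossing side `D₁D₂ ≥ (K/x)² θ^{2(k+1)}` beats the nested side `R² ≤ C²(ℓ_k+1)²`
(exponential against quadratic in `k`): some `ℓ ≥ 1` has `R(ℓ)² < D₁(ℓ)D₂(ℓ)`. [folklore] -/
theorem stub_cornerWindow :
    ∀ (x K C : ℝ) (T R D₁ D₂ : ℕ → ℝ), 0 < x → 0 < K → 0 ≤ C →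
      (∀ p q : ℕ, x * T p * T q ≤ T (p + q + 1)) →
      (∀ p : ℕ, x * T p ≤ T (p + 1)) →
      (∀ p : ℕ, 0 ≤ T p) →
      (∃ p : ℕ, 1 < x * T p) →
      (∀ ℓ : ℕ, 1 ≤ ℓ → K * T (ℓ - 1) ≤ D₁ ℓ) →
      (∀ ℓ : ℕ, 1 ≤ ℓ → K * T (ℓ - 1) ≤ D₂ ℓ) →
      (∀ ℓ : ℕ, 0 ≤ R ℓ) →
      (∀ ℓ : ℕ, R ℓ ≤ C * ((ℓ : ℝ) + 1)) →
      ∃ ℓ : ℕ, 1 ≤ ℓ ∧ R ℓ * R ℓ < D₁ ℓ * D₂ ℓ := by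
  intro x K C T R D₁ D₂ hx hK hC hmul _hmono _hT0 hsup hD₁ hD₂ hR0 hRC
  obtain ⟨p₀, hp₀⟩ := hsup
  have hθ0 : 0 < x * T p₀ := zero_lt_one.trans hp₀
  have hθ2 : 1 < (x * T p₀) ^ 2 := by nlinarith
  have hB : 0 < (K / x) ^ 2 := by positivity
  obtain ⟨k, hk⟩ := exists_sq_lt_pow (A := C ^ 2 * ((p₀ : ℝ) + 2) ^ 2) hB hθ2
  -- the span `ℓ_k = p₀ + k (p₀ + 1) + 1`
  refine ⟨p₀ + k * (p₀ + 1) + 1, by omega, ?_⟩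
  have hgrow := pow_succ_le_through hx hmul p₀ hθ0.le k
  have hsub : p₀ + k * (p₀ + 1) + 1 - 1 = p₀ + k * (p₀ + 1) := by omega
  have h1 := hD₁ (p₀ + k * (p₀ + 1) + 1) (by omega)
  have h2 := hD₂ (p₀ + k * (p₀ + 1) + 1) (by omega)
  rw [hsub] at h1 h2
  -- lower bound of the crossing side
  have hKT : K / x * (x * T p₀) ^ (k + 1) ≤ K * T (p₀ + k * (p₀ + 1)) := by
    rw [div_mul_eq_mul_div, div_le_iff₀ hx]
    calc K * (x * T p₀) ^ (k + 1) ≤ K * (x * T (p₀ + k * (p₀ + 1))) :=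
          mul_le_mul_of_nonneg_left hgrow hK.le
      _ = K * T (p₀ + k * (p₀ + 1)) * x := by ring
  have hpos : 0 ≤ K / x * (x * T p₀) ^ (k + 1) := by positivity
  have hD : K / x * (x * T p₀) ^ (k + 1) * (K / x * (x * T p₀) ^ (k + 1)) ≤
      D₁ (p₀ + k * (p₀ + 1) + 1) * D₂ (p₀ + k * (p₀ + 1) + 1) :=
    mul_le_mul (hKT.trans h1) (hKT.trans h2) hpos (hpos.trans (hKT.trans h1))
  -- upper bound of the nested side
  have hRle := hRC (p₀ + k * (p₀ + 1) + 1)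
  have hR0' := hR0 (p₀ + k * (p₀ + 1) + 1)
  have hu0 : 0 ≤ C * (((p₀ + k * (p₀ + 1) + 1 : ℕ) : ℝ) + 1) := by positivity
  have hu : C * (((p₀ + k * (p₀ + 1) + 1 : ℕ) : ℝ) + 1) ≤ C * (((k : ℝ) + 1) * ((p₀ : ℝ) + 2)) := by
    apply mul_le_mul_of_nonneg_left _ hC
    have hk0 : (0 : ℝ) ≤ k := Nat.cast_nonneg k
    push_cast
    nlinarith
  calc R (p₀ + k * (p₀ + 1) + 1) * R (p₀ + k * (p₀ + 1) + 1)
        ≤ C * (((p₀ + k * (p₀ + 1) + 1 : ℕ) : ℝ) + 1) *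
          (C * (((p₀ + k * (p₀ + 1) + 1 : ℕ) : ℝ) + 1)) :=
        mul_le_mul hRle hRle hR0' (hR0'.trans hRle)
    _ ≤ C * (((k : ℝ) + 1) * ((p₀ : ℝ) + 2)) * (C * (((k : ℝ) + 1) * ((p₀ : ℝ) + 2))) :=
        mul_self_le_mul_self hu0 hu
    _ = C ^ 2 * ((p₀ : ℝ) + 2) ^ 2 * ((k : ℝ) + 1) ^ 2 := by ring
    _ < (K / x) ^ 2 * ((x * T p₀) ^ 2) ^ (k + 1) := hk
    _ = K / x * (x * T p₀) ^ (k + 1) * (K / x * (x * T p₀) ^ (k + 1)) := by ring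
    _ ≤ D₁ (p₀ + k * (p₀ + 1) + 1) * D₂ (p₀ + k * (p₀ + 1) + 1) := hD

end Summit.CriticalPhenomena.SAWScalingLimit.Theorems.EdgeOfPositivity.RectangleWindows.CornerWindow

end
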